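import Mathlib
import HarnessLib
import Summits.HubbardSuperconductivity.HubbardSuperconductivity.Theorems.KLProgrammeKLRegimeBetaSplitEdgeFZ
import Summits.HubbardSuperconductivity.HubbardSuperconductivity.Theorems.KLProgrammeKLRegimeBetaSplitV17F2

/-!
# Route `KLProgramme` — crux K3 gen 8, CHILD 1 (`KLRegimeBetaSplitV17F2`) with an n-FLAT in-class slot `κ·Q.CR·(P.Klam·U)⁴` in the (E2-F2)/(E2″-F)/UV clause budgets:
# `betaSplitP_of_clausesV17F2Z` (clause form), `betaSplitP_of_slotsV17F2Z` / `betaSplitP_klPredsV17F2_zslot` (the current texts through it)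

Cell gate-hubbard-kl, seat hubbard-kl-k3c1-p1 (g28; child-1 lineage; technique «composed-map remainder propagation»).  The RIDER of located #27's cure «Z-slot»
(KL STATUS (R675): registry edit adding one n-flat higher-order in-class slot `σ_Z·(P.Klam·U)⁴` to the (E2-F2) bar; rider «child 1 re-closed») made a kernel fact on
the CURRENT texts.  Over the KL-regime-aware generic closer `betaSplitP_of_edgeClausesFZ` (`…BetaSplitEdgeFZ`):

* §1 the flat slot's algebra: per scale `κ·CR·Klam⁴·U⁴ ≤ CR·Klam³·U²` once `U ≤ 1/(κ·Klam+1)` (`U ≤ 1`); window `n·κ·CR·Klam⁴·U⁴ ≤ CR·Klam³·U²` from the KL-regime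
  line `U²·n·ln 4 ≤ c` once `c ≤ ln 4/(κ·Klam+1)` — an n-flat slot is summable ONLY through the regime line (`n ≤ c/(U² ln 4)`), which is why the landed closer's
  interface (`n ≤ nScales β` alone) could not host it;
* §2 **`betaSplitP_of_clausesV17F2Z κ`** (`0 ≤ κ`): child 1 for every bundle whose split slot is implied by `BetaSplitAtV17F`, whose renorm slot exports (I-F jets)
  and whose engine slot yields, at `(K_n, n)`, the (E2-F2)₀ UV clause / the SIGNED (E2-F2) ladder clause / the (E2″-F) increment clause with the budget family
  `𝔛Z = thermalBar + legDressBarQ2·(flowing count) + (Klam U)²·((phGain)⁺+(phGain)⁺) + frameShiftBar + κ·Q.CR·(P.Klam·U)⁴` (at `1 ≤ j`; `legDressBarQ2 … 0 4` at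
  `j = 0`), sign-defect allowance `2·klEdge`, (E4) at `K_n`, (E5-F).  Numerals `(sG, sQ, tG, tQ, tN) = (3, 10, 10/3, 151/3, 15)` (the landed `(3, 9, 10/3, 148/3, 15)`
  plus ONE unit of `CR·Klam³·U²` per scale and per window for the flat slot; leg line `12(tQ+sQ)+tQ = 774⅓ ≤ klLegKappa = 4000`), `uR R = klE0/(32·Gfr₀+1)` (unchanged),
  `uX = 1/(κ·Klam+1)`, `cX = ln 4/(κ·Klam+1)`;
* §3 **`betaSplitP_of_slotsV17F2Z`** — the CURRENT engine text `EngineBoundsAtV17F2` (no flat slot) yields §2's clauses (slack `κ·Q.CR·(P.Klam·U)⁴ ≥ 0`), hence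
  `BetaSplitP Pr W` through the Z-tolerant cascade, and **`betaSplitP_klPredsV17F2_zslot κ W : BetaSplitP klPredsV17F2 W`** — the bundle of record, end to end.

Reading (for the registry edit, if KEEP): with the slot written `∝ Q.CR` (the `frameShiftBar` pattern, e.g. `Q.CR·(P.Klam·U)⁴`; (R675)'s `σ_Z ≥ 2Z₁κc₄²/Klam⁴` is then a
condition on the raise `Q`) child 1 re-closes with ZERO new constants: the post-edit file is §3 with `EngineBoundsAtV17F3` in place of `…V17F2` and the slot mapped to the
flat summand (≈ 20 lines).  A `G`/`P`-level coefficient would instead have to enter row 0′'s `C_W` algebra (`pairArrayAtV17F_of_edgeClauses_explicit`) — not built here.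
Everything is proved; no definitions; no registered text is edited; nothing about the model is asserted; nothing asserts superconductivity.
-/

noncomputable section

namespace Summit.HubbardSuperconductivity.HubbardSuperconductivity.Theorems.KLRegimeSplit

set_option linter.dupNamespace false -- summit = problem name (single-conjunct summit), D-0017

open Real Finset Literature.MathematicalPhysics.QuantumLattice Literature.Probability.LatticeModels
open Summit.HubbardSuperconductivity.HubbardSuperconductivity.Theorems.KLProgrammeLegKernels
open Summit.HubbardSuperconductivity.HubbardSuperconductivity.Theorems.CooperChannelRiccatiFlow
open Summit.HubbardSuperconductivity.HubbardSuperconductivity.Theorems.DispersionFlow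

/-! ## §1 The flat slot `κ·Q.CR·(P.Klam·U)⁴`: per-scale and window sizes -/

section Flat

/-- The flat slot is nonnegative (`κ, CR ≥ 0`). -/
theorem klbsZ_flat_nonneg {κ : ℝ} (hκ : 0 ≤ κ) {P : SplitConsts} {Q : EngConsts} (hCR : 0 ≤ Q.CR) (U : ℝ) :
    0 ≤ κ * (Q.CR * (P.Klam * U) ^ 4) := by
  have h4 : 0 ≤ (P.Klam * U) ^ 4 := by positivity
  exact mul_nonneg hκ (mul_nonneg hCR h4)

/-- `U ≤ 1/(κ·Klam+1)` gives `κ·Klam·U ≤ 1` (`κ, Klam ≥ 0`). -/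
theorem klbsZ_kappa_mul_le_one {κ Klam U : ℝ} (hκ : 0 ≤ κ) (hK : 0 ≤ Klam) (hUX : U ≤ 1 / (κ * Klam + 1)) :
    κ * Klam * U ≤ 1 := by
  have hpos : 0 < κ * Klam + 1 := by positivity
  have h1 : κ * Klam * U ≤ κ * Klam * (1 / (κ * Klam + 1)) := mul_le_mul_of_nonneg_left hUX (mul_nonneg hκ hK)
  have h2 : κ * Klam * (1 / (κ * Klam + 1)) ≤ 1 := by
    rw [mul_one_div, div_le_one hpos]; linarith
  exact h1.trans h2

/-- **Per scale**: `κ·CR·(Klam U)⁴ ≤ CR·Klam³·U²` once `0 ≤ U ≤ 1` and `U ≤ 1/(κ·Klam+1)`. -/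
theorem klbsZ_flat_le {κ : ℝ} (hκ : 0 ≤ κ) {P : SplitConsts} (hP : 1 ≤ P.Klam) {Q : EngConsts} (hCR : 0 ≤ Q.CR) {U : ℝ} (hU : 0 ≤ U)
    (hU1 : |U| ≤ 1) (hUX : U ≤ 1 / (κ * P.Klam + 1)) : κ * (Q.CR * (P.Klam * U) ^ 4) ≤ Q.CR * P.Klam ^ 3 * U ^ 2 := by
  have hK0 : 0 ≤ P.Klam := zero_le_one.trans hP
  have hKU : κ * P.Klam * U ≤ 1 := klbsZ_kappa_mul_le_one hκ hK0 hUX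
  have hU1' : U ≤ 1 := (le_abs_self U).trans hU1
  have hq30 : 0 ≤ Q.CR * P.Klam ^ 3 * U ^ 2 := by positivity
  have hKUU : κ * P.Klam * U * U ≤ 1 := by nlinarith [mul_nonneg (mul_nonneg hκ hK0) hU]
  calc κ * (Q.CR * (P.Klam * U) ^ 4) = (κ * P.Klam * U * U) * (Q.CR * P.Klam ^ 3 * U ^ 2) := by ring
    _ ≤ 1 * (Q.CR * P.Klam ^ 3 * U ^ 2) := mul_le_mul_of_nonneg_right hKUU hq30
    _ = Q.CR * P.Klam ^ 3 * U ^ 2 := one_mul _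

/-- The KL-regime line in real form: `IsKLRegime U c (−n)` is `U²·n·ln 4 ≤ c`. -/
theorem klbsZ_regime_line {U c : ℝ} {n : ℕ} (hKL : IsKLRegime U c (-(n : ℤ))) : U ^ 2 * (n : ℝ) * Real.log 4 ≤ c := by
  have h := hKL
  unfold IsKLRegime at h
  have habs : |((-(n : ℤ) : ℤ) : ℝ)| = (n : ℝ) := by
    rw [Int.cast_neg, Int.cast_natCast, abs_neg, Nat.abs_cast]
  rwa [habs] at h

/-- **Per window**: `n·κ·CR·(Klam U)⁴ ≤ CR·Klam³·U²` from the KL-regime line `U²·n·ln 4 ≤ c` once `c ≤ ln 4/(κ·Klam+1)`. -/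
theorem klbsZ_flat_window_le {κ : ℝ} (hκ : 0 ≤ κ) {P : SplitConsts} (hP : 1 ≤ P.Klam) {Q : EngConsts} (hCR : 0 ≤ Q.CR) {U c : ℝ}
    (hcX : c ≤ Real.log 4 / (κ * P.Klam + 1)) {n : ℕ} (hKL : IsKLRegime U c (-(n : ℤ))) :
    (n : ℝ) * (κ * (Q.CR * (P.Klam * U) ^ 4)) ≤ Q.CR * P.Klam ^ 3 * U ^ 2 := by
  have hK0 : 0 ≤ P.Klam := zero_le_one.trans hP
  have hlog4 : 0 < Real.log 4 := Real.log_pos (by norm_num)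
  have hpos : 0 < κ * P.Klam + 1 := by positivity
  have hreg := klbsZ_regime_line hKL
  -- `(κ Klam + 1)·(U² n)·ln 4 ≤ (κ Klam + 1)·c ≤ ln 4`, hence `(κ Klam + 1)·U²·n ≤ 1`
  have h1 : (κ * P.Klam + 1) * c ≤ Real.log 4 := by
    have := (le_div_iff₀ hpos).1 hcX; linarith
  have h2 : (κ * P.Klam + 1) * (U ^ 2 * (n : ℝ)) * Real.log 4 ≤ Real.log 4 := by
    have := mul_le_mul_of_nonneg_left hreg hpos.le
    nlinarith
  have h3 : (κ * P.Klam + 1) * (U ^ 2 * (n : ℝ)) ≤ 1 :=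
    le_of_mul_le_mul_right (by linarith) hlog4
  have hn0 : (0 : ℝ) ≤ n := Nat.cast_nonneg n
  have h4 : κ * P.Klam * (U ^ 2 * (n : ℝ)) ≤ 1 := by nlinarith [mul_nonneg (sq_nonneg U) hn0]
  have hq30 : 0 ≤ Q.CR * P.Klam ^ 3 * U ^ 2 := by positivity
  calc (n : ℝ) * (κ * (Q.CR * (P.Klam * U) ^ 4)) = (κ * P.Klam * (U ^ 2 * (n : ℝ))) * (Q.CR * P.Klam ^ 3 * U ^ 2) := by ring
    _ ≤ 1 * (Q.CR * P.Klam ^ 3 * U ^ 2) := mul_le_mul_of_nonneg_right h4 hq30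
    _ = Q.CR * P.Klam ^ 3 * U ^ 2 := one_mul _

/-- Window sum over `(t, n]`: `Σ_{j ∈ (t,n]} κ·CR·(Klam U)⁴ ≤ CR·Klam³·U²` (the summand is `j`-free; `#(t,n] ≤ n`). -/
theorem klbsZ_flat_sum_Ioc_le {κ : ℝ} (hκ : 0 ≤ κ) {P : SplitConsts} (hP : 1 ≤ P.Klam) {Q : EngConsts} (hCR : 0 ≤ Q.CR) {U c : ℝ}
    (hcX : c ≤ Real.log 4 / (κ * P.Klam + 1)) {t n : ℕ} (hKL : IsKLRegime U c (-(n : ℤ))) :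
    ∑ _j ∈ Ioc t n, κ * (Q.CR * (P.Klam * U) ^ 4) ≤ Q.CR * P.Klam ^ 3 * U ^ 2 := by
  rw [sum_const, Nat.card_Ioc, nsmul_eq_mul]
  have hx : 0 ≤ κ * (Q.CR * (P.Klam * U) ^ 4) := klbsZ_flat_nonneg hκ hCR U
  have hle : ((n - t : ℕ) : ℝ) ≤ (n : ℝ) := by exact_mod_cast Nat.sub_le n t
  exact (mul_le_mul_of_nonneg_right hle hx).trans (klbsZ_flat_window_le hκ hP hCR hcX hKL)

/-- Window sum over `range n` (shifted family): `Σ_{i<n} κ·CR·(Klam U)⁴ ≤ CR·Klam³·U²`. -/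
theorem klbsZ_flat_sum_range_le {κ : ℝ} (hκ : 0 ≤ κ) {P : SplitConsts} (hP : 1 ≤ P.Klam) {Q : EngConsts} (hCR : 0 ≤ Q.CR) {U c : ℝ}
    (hcX : c ≤ Real.log 4 / (κ * P.Klam + 1)) {n : ℕ} (hKL : IsKLRegime U c (-(n : ℤ))) :
    ∑ _i ∈ range n, κ * (Q.CR * (P.Klam * U) ^ 4) ≤ Q.CR * P.Klam ^ 3 * U ^ 2 := by
  rw [sum_const, card_range, nsmul_eq_mul]
  exact klbsZ_flat_window_le hκ hP hCR hcX hKL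

end Flat

/-! ## §2 Child 1 at clause level with the flat slot in the budgets -/

/-- **Child 1 at clause level with the n-flat in-class slot `κ·Q.CR·(P.Klam·U)⁴` (`0 ≤ κ`), every bundle and window.**  If `BetaSplitAtV17F ⇒ Pr.split`,
`Pr.renorm … R j ⇒ FlowPieceJetsAt … R j`, and the engine slot `Pr.engine … n` yields at `(K_n, n)`: the (E2-F2)₀ UV clause (budget `initDevBar + legDressBarQ2 … 0 4`),
the SIGNED (E2-F2) ladder clause and the (E2″-F) increment clause with the budget family `𝔛Z = thermalBar + legDressBarQ2·(legSliceCountT at K_j) +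
(Klam U)²·((phGain)⁺ + (phGain)⁺) + frameShiftBar + (κ·Q.CR·(P.Klam·U)⁴)⁺` (`(x)⁺ = max x 0`, manifestly nonnegative like the landed (X) term — no `Q.WF` needed where the engine clauses are produced) and the sign-defect allowance `2·klEdge`, (E4) at `K_n` and (E5-F) — THEN `BetaSplitP Pr W`.
Proof = `betaSplitP_of_edgeClausesFZ` with numerals `(3, 10, 10/3, 151/3, 15)`, `uR R = klE0/(32·Gfr₀+1)`, `uX = 1/(κ·Klam+1)`, `cX = ln 4/(κ·Klam+1)`; per-scale and
scale-sum bounds = the landed V17F2 ones (`betaSplitP_of_slotsV17F2`) plus §1 for the flat slot. -/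
theorem betaSplitP_of_clausesV17F2Z {Pr : Preds} {W : Set ℝ} (κ : ℝ) (hκ : 0 ≤ κ)
    (hs : ∀ (L M : ℕ) [NeZero L] [NeZero M] (G : GeoConsts) (P : SplitConsts) (Q : EngConsts) (β U μ : ℝ) (K : TrigPolyC4v) (n : ℕ),
      BetaSplitAtV17F L M G P Q β U μ n → Pr.split L M G P Q β U μ K n)
    (hr : ∀ (L M : ℕ) [NeZero L] [NeZero M] (β U μ : ℝ) (K : TrigPolyC4v) (R : RenConsts) (n : ℕ),
      Pr.renorm L M β U μ K R n → FlowPieceJetsAt L M β U μ R n)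
    (he : ∀ (L M : ℕ) [NeZero L] [NeZero M] (G : GeoConsts) (P : SplitConsts) (Q : EngConsts) (β U μ : ℝ) (K : TrigPolyC4v) (n : ℕ),
      Pr.engine L M G P Q β U μ K n →
        (n = 0 → ∀ Qm : TorusSite 2 L, ∀ k ∈ klBall L μ 0, ∀ k' ∈ klBall L μ 0,
          ‖klPairAmplitude L M β U μ (klFlowFrameU L M β U μ 0) 0 Qm k k' - (U : ℂ)‖ ≤ initDevBar G U + legDressBarQ2 G P Q U 0 4) ∧
        (1 ≤ n → ∀ Qm : TorusSite 2 L, IsPairClassAt L Qm n →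
          ∃ w : TorusSite 2 L → ℝ, (∑ p, |w p| ≤ G.bhi) ∧ (∑ p, (|w p| - w p) ≤ 2 * klEdge G n (klTorusNorm L Qm)) ∧
            ∃ N : Matrix (TorusSite 2 L) (TorusSite 2 L) ℂ,
              (1 + Matrix.diagonal (fun p => (w p : ℂ)) * klPairArrayF L M β U μ (n - 1) Qm) * N = 1 ∧
              ∀ k ∈ klBall L μ 0, ∀ k' ∈ klBall L μ 0,
                ‖klPairAmplitude L M β U μ (klFlowFrameU L M β U μ n) n Qm k k' - (klPairArrayF L M β U μ (n - 1) Qm * N) k k'‖ ≤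
                  drivePBar G P U (n - 1) + eremBar G P Q U β L (n - 1) +
                    (thermalBar G P U β n + legDressBarQ2 G P Q U n (legSliceCountT L β μ (klFlowFrameU L M β U μ n) n ![k', Qm - k', Qm - k, k]) +
                      (P.Klam * U) ^ 2 * (max (G.phGain n (klTorusNorm L (k - k'))) 0 + max (G.phGain n (klTorusNorm L (k + k' - Qm))) 0) +
                      frameShiftBar P Q U n + max (κ * (Q.CR * (P.Klam * U) ^ 4)) 0)) ∧
        (1 ≤ n → ∀ Qm : TorusSite 2 L, ∀ k ∈ klBall L μ 0, ∀ k' ∈ klBall L μ 0,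
          ‖klPairAmplitude L M β U μ (klFlowFrameU L M β U μ n) n Qm k k' - klPairAmplitude L M β U μ (klFlowFrameU L M β U μ (n - 1)) (n - 1) Qm k k'‖ ≤
            gainBar G P U n (klTorusNorm L Qm) (klTorusNorm L (k - k')) (klTorusNorm L (k + k' - Qm)) + eremBar G P Q U β L (n - 1) +
              (thermalBar G P U β n + legDressBarQ2 G P Q U n (legSliceCountT L β μ (klFlowFrameU L M β U μ n) n ![k', Qm - k', Qm - k, k]) +
                (P.Klam * U) ^ 2 * (max (G.phGain n (klTorusNorm L (k - k'))) 0 + max (G.phGain n (klTorusNorm L (k + k' - Qm))) 0) +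
                frameShiftBar P Q U n + max (κ * (Q.CR * (P.Klam * U) ^ 4)) 0)) ∧
        EngineFirstMoments L M G P Q β U μ (klFlowFrameU L M β U μ n) n ∧ IsoTupleL1AtV17F L M G P β U μ n) :
    BetaSplitP Pr W := by
  refine betaSplitP_of_edgeClausesFZ (Pr := Pr) (sG := 3) (sQ := 10) (tG := 10 / 3) (tQ := 151 / 3) (tN := 15) (by norm_num) (by norm_num)
    (by norm_num) (by norm_num) (by norm_num) (by unfold klLegKappa; norm_num)
    (fun R => klE0 / (32 * R.Gfr 0 + 1)) (fun R hR => div_pos (by norm_num [klE0]) (by linarith [hR.2.2 0]))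
    (fun _ P _ => 1 / (κ * P.Klam + 1)) (fun _ P _ => Real.log 4 / (κ * P.Klam + 1))
    (fun G P Q _ hP _ => by
      have hK0 : 0 ≤ P.Klam := zero_le_one.trans hP.1
      positivity)
    (fun G P Q _ hP _ => by
      have hK0 : 0 ≤ P.Klam := zero_le_one.trans hP.1
      have hlog4 : 0 < Real.log 4 := Real.log_pos (by norm_num)
      positivity)
    (fun L M _ _ G P Q β U μ j Qm k k' =>
      if 1 ≤ j then thermalBar G P U β j + legDressBarQ2 G P Q U j (legSliceCountT L β μ (klFlowFrameU L M β U μ j) j ![k', Qm - k', Qm - k, k]) +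
        (P.Klam * U) ^ 2 * (max (G.phGain j (klTorusNorm L (k - k'))) 0 + max (G.phGain j (klTorusNorm L (k + k' - Qm))) 0) +
        frameShiftBar P Q U j + max (κ * (Q.CR * (P.Klam * U) ^ 4)) 0
      else legDressBarQ2 G P Q U 0 4)
    ?_ ?_ ?_ ?_ (fun L G P Q β U μ j Qm => 2 * klEdge G j (klTorusNorm L Qm)) ?_ hs ?_
  · -- nonnegativity
    intro L M _ _ G P Q β U μ j Qm k k' hG hP hQ
    have hCF : 0 ≤ G.CF := hG.2.2.2.2.2.2.2.2.2.2.2.2.2.1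
    have hK0 : 0 ≤ P.Klam := zero_le_one.trans hP.1
    split_ifs
    · exact add_nonneg (add_nonneg (add_nonneg (add_nonneg (thermalBar_nonneg hCF P U β j) (legDressBarQ2_nonneg G hK0 hQ.2.1 U j _))
        (klbs9_X_nonneg G P U j _ _)) (frameShiftBar_nonneg hQ.2.1 U j)) (le_max_right _ _)
    · exact legDressBarQ2_nonneg G hK0 hQ.2.1 U 0 _
  · -- per-scale size (`≤ 3·CF(Klam U)² + 10·CR·Klam³·U²`; the flat slot takes ONE unit under `U ≤ 1/(κ·Klam+1)`)
    intro L M _ _ G P Q β U μ j Qm k k' hG hP hQ hU hU1 hUX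
    have hCF : 0 ≤ G.CF := hG.2.2.2.2.2.2.2.2.2.2.2.2.2.1
    have hK0 : 0 ≤ P.Klam := zero_le_one.trans hP.1
    have hCR : 0 ≤ Q.CR := hQ.2.1
    have hcr3 := cr3_le hP.1 hCR hU1
    have hq30 : 0 ≤ Q.CR * P.Klam ^ 3 * U ^ 2 := by positivity
    have hg20 : 0 ≤ G.CF * (P.Klam * U) ^ 2 := by positivity
    split_ifs with hj
    · have h1 := thermalBar_le hCF P U β j
      have h2 := legDressBarQ2_le G hK0 hCR U j (legSliceCountT L β μ (klFlowFrameU L M β U μ j) j ![k', Qm - k', Qm - k, k])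
      have h4 : (legSliceCountT L β μ (klFlowFrameU L M β U μ j) j ![k', Qm - k', Qm - k, k] : ℝ) ≤ 4 := by
        exact_mod_cast legSliceCountT_le_four L β μ (klFlowFrameU L M β U μ j) j _
      have h3 : Q.CR * ((P.Klam * U) ^ 2 + (P.Klam * |U|) ^ 3) * (legSliceCountT L β μ (klFlowFrameU L M β U μ j) j ![k', Qm - k', Qm - k, k] : ℝ) ≤
          2 * Q.CR * P.Klam ^ 3 * U ^ 2 * 4 := mul_le_mul hcr3 h4 (Nat.cast_nonneg _) (by positivity)
      have h5 : (P.Klam * U) ^ 2 * (max (G.phGain j (klTorusNorm L (k - k'))) 0 + max (G.phGain j (klTorusNorm L (k + k' - Qm))) 0) ≤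
          2 * (G.CF * (P.Klam * U) ^ 2) := klbs9_X_le hG P U j (torusSupNorm_nonneg _) (torusSupNorm_nonneg _)
      have h6 := frameShiftBar_le_cube hP.1 hCR U j
      have h7 : max (κ * (Q.CR * (P.Klam * U) ^ 4)) 0 ≤ Q.CR * P.Klam ^ 3 * U ^ 2 := by
        rw [max_eq_left (klbsZ_flat_nonneg hκ hCR U)]; exact klbsZ_flat_le hκ hP.1 hCR hU hU1 hUX
      linarith
    · have h2 := legDressBarQ2_le G hK0 hCR U 0 4
      have h3 : Q.CR * ((P.Klam * U) ^ 2 + (P.Klam * |U|) ^ 3) * ((4 : ℕ) : ℝ) ≤ 2 * Q.CR * P.Klam ^ 3 * U ^ 2 * 4 := by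
        rw [Nat.cast_ofNat]; nlinarith [hcr3]
      linarith
  · -- scale sums over `(t, n]`: V17F2's four families + the flat slot through the KL-regime line
    intro L M _ _ G P Q R β U μ K t n Qm k k' c hG hP hQ hR hU hU1 hUR hUX hc hcX hn hKL hHist
    have hCF : 0 ≤ G.CF := hG.2.2.2.2.2.2.2.2.2.2.2.2.2.1
    have hK0 : 0 ≤ P.Klam := zero_le_one.trans hP.1
    have hCR : 0 ≤ Q.CR := hQ.2.1
    have hcr3 := cr3_le hP.1 hCR hU1
    have hq30 : 0 ≤ Q.CR * P.Klam ^ 3 * U ^ 2 := by positivity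
    have hGfr : 0 ≤ R.Gfr 0 := hR.2.2 0
    have hU32 : 32 * R.Gfr 0 * |U| ≤ klE0 := klbsF_rate_smallness hU hGfr hUR
    have hJ : ∀ m < n, FlowPieceJetsAt L M β U μ R m := fun m hm => hr L M β U μ K R m (hHist m hm).2.1
    have heq : ∀ j ∈ Ioc t n, (if 1 ≤ j then thermalBar G P U β j +
        legDressBarQ2 G P Q U j (legSliceCountT L β μ (klFlowFrameU L M β U μ j) j ![k', Qm - k', Qm - k, k]) +
        (P.Klam * U) ^ 2 * (max (G.phGain j (klTorusNorm L (k - k'))) 0 + max (G.phGain j (klTorusNorm L (k + k' - Qm))) 0) +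
        frameShiftBar P Q U j + max (κ * (Q.CR * (P.Klam * U) ^ 4)) 0
        else legDressBarQ2 G P Q U 0 4) =
        thermalBar G P U β j + legDressBarQ2 G P Q U j (legSliceCountT L β μ (klFlowFrameU L M β U μ j) j ![k', Qm - k', Qm - k, k]) +
        (P.Klam * U) ^ 2 * (max (G.phGain j (klTorusNorm L (k - k'))) 0 + max (G.phGain j (klTorusNorm L (k + k' - Qm))) 0) +
        frameShiftBar P Q U j + max (κ * (Q.CR * (P.Klam * U) ^ 4)) 0 := by
      intro j hj
      simp only [mem_Ioc] at hj
      rw [if_pos (by omega)]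
    rw [sum_congr rfl heq, sum_add_distrib, sum_add_distrib, sum_add_distrib, sum_add_distrib]
    have hsub : ∀ (f : ℕ → ℝ), (∀ j, 0 ≤ f j) → ∑ j ∈ Ioc t n, f j ≤ ∑ j ∈ range (n + 1), f j := fun f hf =>
      sum_le_sum_of_subset_of_nonneg (fun j hj => by simp only [mem_Ioc] at hj; exact mem_range.2 (by omega)) fun j _ _ => hf j
    have h1 : ∑ j ∈ Ioc t n, thermalBar G P U β j ≤ 4 / 3 * (G.CF * (P.Klam * U) ^ 2) :=
      (hsub _ fun j => thermalBar_nonneg hCF P U β j).trans (thermalBar_sum_le hCF P U β hn)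
    have h2 : ∑ j ∈ Ioc t n, legDressBarQ2 G P Q U j (legSliceCountT L β μ (klFlowFrameU L M β U μ j) j ![k', Qm - k', Qm - k, k]) ≤
        20 * (2 * Q.CR * P.Klam ^ 3 * U ^ 2) :=
      ((hsub _ fun j => legDressBarQ2_nonneg G hK0 hCR U j _).trans
          (legDressBarQ2_countT_flowFrameU_sum_le L M G hK0 hCR hJ hGfr hU32 _)).trans (by nlinarith [hcr3])
    have h3 : ∑ j ∈ Ioc t n, (P.Klam * U) ^ 2 * (max (G.phGain j (klTorusNorm L (k - k'))) 0 + max (G.phGain j (klTorusNorm L (k + k' - Qm))) 0) ≤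
        2 * (G.CF * (P.Klam * U) ^ 2) :=
      (hsub _ fun j => klbs9_X_nonneg G P U j _ _).trans
        (klbs9_X_sum_le hG P U (n + 1) (torusSupNorm_nonneg _) (torusSupNorm_nonneg _))
    have h4 : ∑ j ∈ Ioc t n, frameShiftBar P Q U j ≤ 4 / 3 * (Q.CR * P.Klam ^ 3 * U ^ 2) :=
      (hsub _ fun j => frameShiftBar_nonneg hCR U j).trans (sum_frameShiftBar_le_cube' hP.1 hCR U (n + 1))
    have h5 : ∑ _j ∈ Ioc t n, max (κ * (Q.CR * (P.Klam * U) ^ 4)) 0 ≤ Q.CR * P.Klam ^ 3 * U ^ 2 := by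
      simp only [max_eq_left (klbsZ_flat_nonneg hκ hCR U)]; exact klbsZ_flat_sum_Ioc_le hκ hP.1 hCR hcX hKL
    linarith
  · -- scale sums `m ≤ n`: the scale-0 term plus the shifted inductive sums (flat slot: `n` copies, through the KL-regime line)
    intro L M _ _ G P Q R β U μ K n Qm k k' c hG hP hQ hR hU hU1 hUR hUX hc hcX hn hKL hHist
    have hCF : 0 ≤ G.CF := hG.2.2.2.2.2.2.2.2.2.2.2.2.2.1
    have hK0 : 0 ≤ P.Klam := zero_le_one.trans hP.1
    have hCR : 0 ≤ Q.CR := hQ.2.1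
    have hcr3 := cr3_le hP.1 hCR hU1
    have hq30 : 0 ≤ Q.CR * P.Klam ^ 3 * U ^ 2 := by positivity
    have hGfr : 0 ≤ R.Gfr 0 := hR.2.2 0
    have hU32 : 32 * R.Gfr 0 * |U| ≤ klE0 := klbsF_rate_smallness hU hGfr hUR
    have hJ : ∀ m < n, FlowPieceJetsAt L M β U μ R m := fun m hm => hr L M β U μ K R m (hHist m hm).2.1
    have heq : ∀ i ∈ range n, (if 1 ≤ i + 1 then thermalBar G P U β (i + 1) +
        legDressBarQ2 G P Q U (i + 1) (legSliceCountT L β μ (klFlowFrameU L M β U μ (i + 1)) (i + 1) ![k', Qm - k', Qm - k, k]) +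
        (P.Klam * U) ^ 2 * (max (G.phGain (i + 1) (klTorusNorm L (k - k'))) 0 + max (G.phGain (i + 1) (klTorusNorm L (k + k' - Qm))) 0) +
        frameShiftBar P Q U (i + 1) + max (κ * (Q.CR * (P.Klam * U) ^ 4)) 0
        else legDressBarQ2 G P Q U 0 4) =
        thermalBar G P U β (i + 1) +
        legDressBarQ2 G P Q U (i + 1) (legSliceCountT L β μ (klFlowFrameU L M β U μ (i + 1)) (i + 1) ![k', Qm - k', Qm - k, k]) +
        (P.Klam * U) ^ 2 * (max (G.phGain (i + 1) (klTorusNorm L (k - k'))) 0 + max (G.phGain (i + 1) (klTorusNorm L (k + k' - Qm))) 0) +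
        frameShiftBar P Q U (i + 1) + max (κ * (Q.CR * (P.Klam * U) ^ 4)) 0 :=
      fun i _ => by rw [if_pos (by omega)]
    rw [if_neg (by omega), sum_congr rfl heq, sum_add_distrib, sum_add_distrib, sum_add_distrib, sum_add_distrib]
    have h0 := legDressBarQ2_le G hK0 hCR U 0 4
    have h0' : Q.CR * ((P.Klam * U) ^ 2 + (P.Klam * |U|) ^ 3) * ((4 : ℕ) : ℝ) ≤ 2 * Q.CR * P.Klam ^ 3 * U ^ 2 * 4 := by
      rw [Nat.cast_ofNat]; nlinarith [hcr3]
    have h1 : ∑ i ∈ range n, thermalBar G P U β (i + 1) ≤ 4 / 3 * (G.CF * (P.Klam * U) ^ 2) :=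
      (sum_range_succ_shift_le (f := fun m => thermalBar G P U β m) (fun m => thermalBar_nonneg hCF P U β m) n).trans
        (thermalBar_sum_le hCF P U β hn)
    have h2 : ∑ i ∈ range n, legDressBarQ2 G P Q U (i + 1)
        (legSliceCountT L β μ (klFlowFrameU L M β U μ (i + 1)) (i + 1) ![k', Qm - k', Qm - k, k]) ≤ 20 * (2 * Q.CR * P.Klam ^ 3 * U ^ 2) :=
      ((sum_range_succ_shift_le
          (f := fun m => legDressBarQ2 G P Q U m (legSliceCountT L β μ (klFlowFrameU L M β U μ m) m ![k', Qm - k', Qm - k, k]))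
          (fun m => legDressBarQ2_nonneg G hK0 hCR U m _) n).trans
          (legDressBarQ2_countT_flowFrameU_sum_le L M G hK0 hCR hJ hGfr hU32 _)).trans (by nlinarith [hcr3])
    have h3 : ∑ i ∈ range n, (P.Klam * U) ^ 2 *
        (max (G.phGain (i + 1) (klTorusNorm L (k - k'))) 0 + max (G.phGain (i + 1) (klTorusNorm L (k + k' - Qm))) 0) ≤
        2 * (G.CF * (P.Klam * U) ^ 2) :=
      (sum_range_succ_shift_le
          (f := fun m => (P.Klam * U) ^ 2 * (max (G.phGain m (klTorusNorm L (k - k'))) 0 + max (G.phGain m (klTorusNorm L (k + k' - Qm))) 0))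
          (fun m => klbs9_X_nonneg G P U m _ _) n).trans
        (klbs9_X_sum_le hG P U (n + 1) (torusSupNorm_nonneg _) (torusSupNorm_nonneg _))
    have h4 : ∑ i ∈ range n, frameShiftBar P Q U (i + 1) ≤ 4 / 3 * (Q.CR * P.Klam ^ 3 * U ^ 2) :=
      (sum_range_succ_shift_le (f := fun m => frameShiftBar P Q U m) (fun m => frameShiftBar_nonneg hCR U m) n).trans
        (sum_frameShiftBar_le_cube' hP.1 hCR U (n + 1))
    have h5 : ∑ _i ∈ range n, max (κ * (Q.CR * (P.Klam * U) ^ 4)) 0 ≤ Q.CR * P.Klam ^ 3 * U ^ 2 := by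
      simp only [max_eq_left (klbsZ_flat_nonneg hκ hCR U)]; exact klbsZ_flat_sum_range_le hκ hP.1 hCR hcX hKL
    linarith
  · -- the sign-defect allowance `2·klEdge` is in-class scale-summable (verbatim from p475114)
    intro L G P Q β U μ t Qm hG hP hQ hU hU1 ht hQt
    have hbhi : 0 ≤ G.bhi := hG.2.2.1.trans hG.2.2.2.1
    have h1 : ∑ i ∈ range t, 2 * klEdge G (i + 1) (klTorusNorm L Qm) =
        2 * G.bhi * ∑ i ∈ range t, min 1 ((2 * (4 : ℝ) ^ 5) * klTorusNorm L Qm * (4 : ℝ) ^ (i + 1)) := by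
      rw [mul_sum]
      refine sum_congr rfl fun i _ => ?_
      rw [klEdge_eq_pow, show 2 * klTorusNorm L Qm * (4 : ℝ) ^ (i + 1 + 5) = (2 * (4 : ℝ) ^ 5) * klTorusNorm L Qm * (4 : ℝ) ^ (i + 1) by
        rw [pow_add]; ring]
      ring
    have h2 : ∑ i ∈ range t, min 1 ((2 * (4 : ℝ) ^ 5) * klTorusNorm L Qm * (4 : ℝ) ^ (i + 1)) ≤ 22 / 3 :=
      (sum_min_one_edge_le (s := 6) (torusSupNorm_nonneg _) (by norm_num) hQt).trans (by norm_num)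
    rw [h1]
    refine (mul_le_mul_of_nonneg_left h2 (by positivity : (0 : ℝ) ≤ 2 * G.bhi)).trans ?_
    linarith
  · -- the engine clauses, with the `if`-family of the closer unfolded at `j = 0` / `1 ≤ j`
    intro L M _ _ G P Q β U μ K n h
    have h' := he L M G P Q β U μ K n h
    refine ⟨fun hn0 Qm k hk k' hk' => ?_, fun hn1 Qm hQ => ?_, fun hn1 Qm k hk k' hk' => ?_, h'.2.2.2.1, h'.2.2.2.2⟩
    · rw [if_neg (by omega)]
      exact h'.1 hn0 Qm k hk k' hk'
    · obtain ⟨w, hwabs, hwneg, N, hN, hb⟩ := h'.2.1 hn1 Qm hQ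
      refine ⟨w, hwabs, hwneg, N, hN, fun k hk k' hk' => (hb k hk k' hk').trans_eq ?_⟩
      rw [if_pos hn1]
    · rw [if_pos hn1]
      exact h'.2.2.1 hn1 Qm k hk k' hk'

/-! ## §3 The current texts through the Z-tolerant cascade -/

/-- **Child 1 at slot level for the CURRENT cured scheme-F texts through the Z-tolerant cascade** (`0 ≤ κ`): `BetaSplitAtV17F ⇒ Pr.split`,
`Pr.engine ⇒ EngineBoundsAtV17F2` (NO flat slot in the text), `Pr.renorm … R j ⇒ FlowPieceJetsAt … R j` ⟹ `BetaSplitP Pr W`, via `betaSplitP_of_clausesV17F2Z κ` —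
the engine text's own (E2-F2)/(E2″-F) bars sit below the Z-budgets (the landed slack of `betaSplitP_of_slotsV17F2` plus `κ·Q.CR·(P.Klam·U)⁴ ≥ 0`).  The post-edit
re-closure (if the registry adds the slot to the text) is this proof with the slot mapped to the flat summand instead of dropped as slack. -/
theorem betaSplitP_of_slotsV17F2Z {Pr : Preds} {W : Set ℝ} (κ : ℝ) (hκ : 0 ≤ κ)
    (hs : ∀ (L M : ℕ) [NeZero L] [NeZero M] (G : GeoConsts) (P : SplitConsts) (Q : EngConsts) (β U μ : ℝ) (K : TrigPolyC4v) (n : ℕ),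
      BetaSplitAtV17F L M G P Q β U μ n → Pr.split L M G P Q β U μ K n)
    (he : ∀ (L M : ℕ) [NeZero L] [NeZero M] (G : GeoConsts) (P : SplitConsts) (Q : EngConsts) (β U μ : ℝ) (K : TrigPolyC4v) (n : ℕ),
      Pr.engine L M G P Q β U μ K n → EngineBoundsAtV17F2 L M G P Q β U μ n)
    (hr : ∀ (L M : ℕ) [NeZero L] [NeZero M] (β U μ : ℝ) (K : TrigPolyC4v) (R : RenConsts) (n : ℕ),
      Pr.renorm L M β U μ K R n → FlowPieceJetsAt L M β U μ R n) :
    BetaSplitP Pr W := by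
  refine betaSplitP_of_clausesV17F2Z (Pr := Pr) κ hκ hs hr fun L M _ _ G P Q β U μ K n h => ?_
  have h' : EngineBoundsAtV17F2 L M G P Q β U μ n := he L M G P Q β U μ K n h
  refine ⟨fun hn0 Qm k hk k' hk' => h'.2.2.1.1 hn0 Qm k hk k' hk', fun hn1 Qm hQ => ?_, fun hn1 Qm k hk k' hk' => ?_, h'.2.2.2.2.2.2.1,
    h'.2.2.2.2.2.2.2⟩
  · obtain ⟨w, hwabs, hwneg, N, hN, hb⟩ := h'.2.2.1.2 hn1 Qm hQ
    refine ⟨w, hwabs, hwneg, N, hN, fun k hk k' hk' => (hb k hk k' hk').trans ?_⟩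
    have hx := klbs9_X_le_X G P U n (klTorusNorm L (k - k')) (klTorusNorm L (k + k' - Qm))
    have hz : 0 ≤ max (κ * (Q.CR * (P.Klam * U) ^ 4)) 0 := le_max_right _ _
    linarith
  · have hx := klbs9_X_nonneg G P U n (klTorusNorm L (k - k')) (klTorusNorm L (k + k' - Qm))
    have hz : 0 ≤ max (κ * (Q.CR * (P.Klam * U) ^ 4)) 0 := le_max_right _ _
    refine (h'.2.2.2.1 hn1 Qm k hk k' hk').trans ?_
    linarith

/-- **Child 1 at the bundle of record `klPredsV17F2` through the Z-tolerant cascade, every covariance window** (`0 ≤ κ`): `split = BetaSplitAtV17F`,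
`engine = EngineBoundsAtV17F2` by `rfl`; the renorm slot `RenormFlowAtV17F` carries (I-F jets) as its second conjunct.  The kernel-checked form of (R675)'s
«by value harmless»: the β-split tolerance `(P.C_W + klLegKappa·Q.CR·P.Klam³)·U²` absorbs an n-flat in-class slot `κ·Q.CR·(P.Klam·U)⁴` for EVERY `κ ≥ 0`
(constants: `c₀ ↦ min(c₀, ln 4/(κ·Klam+1))`, `U₀ ↦ min(U₀, 1/(κ·Klam+1))`, leg line `774⅓ ≤ 4000`). -/
theorem betaSplitP_klPredsV17F2_zslot (κ : ℝ) (hκ : 0 ≤ κ) (W : Set ℝ) : BetaSplitP klPredsV17F2 W :=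
  betaSplitP_of_slotsV17F2Z (Pr := klPredsV17F2) κ hκ (fun _ _ _ _ _ _ _ _ _ _ _ _ h => h) (fun _ _ _ _ _ _ _ _ _ _ _ _ h => h)
    (fun _ _ _ _ _ _ _ _ _ _ h => h.2.1)

end Summit.HubbardSuperconductivity.HubbardSuperconductivity.Theorems.KLRegimeSplit

end
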